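import Summits.MatrixMultiplication.OmegaCensus.DominoZ5Z5Enumeration
import Summits.MatrixMultiplication.OmegaCensus.DominoZpZpGL2
import Summits.MatrixMultiplication.OmegaCensus.Z4Z4Characters
import HarnessLib

/-!
# No domino cube law with a part of size `3` or `4` over any `A ↠ ℤ₅ × ℤ₅`

ω-census `pub-omega`, family (b3), seat pub-omega-group gen 19 (re-filed by gen 22 with the two fibre-count bridges taken from `DominoZpZpGL2`).  Framing: lottery ticket; floor = certified bounds/negative
ranges.  VALUE: kernel theorems opening the `ℤ_p²`-quotient column (`p = 5`) of the Dih-side mod-one classification — the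
cells `(1,3,e)` and `(1,4,e)` over EVERY finite abelian group with a `ℤ₅ × ℤ₅` quotient, all orders, any `c₀` (census cells
`(1,3,36)@325`, `(1,4,27)@325`, `(1,3,61)@550`, `(1,4,52)@625` ×4 groups, `(1,3,86)@775`, `(1,4,77)@925`, …); NOT progress on ω.

Method (new; no cyclotomic arithmetic): `domino_shifted_form_of_law` ⇒ `X, Y, β, γ, x₀`; translate the image multiset of
`X` by `Φ(3β)` (`3 = ½` in `ZMod 5`): `F u = |X ∩ Φ⁻¹(u + Φ(3β))|`; the enumeration `Z5Z5Domino.exists_table_entry_three/four`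
gives a line direction `w` whose projection of `F` is a certified entry of `table3/4`; the normalised line identity along
`φ = ⟨w, Φ·⟩` (`line_identity_of_shifted_form`) is exactly the identity that `lineCert_sound` excludes.

* `no_shifted_form_of_onto_z5z5` — the core statement at the level of shifted forms (`|X| ∈ {3, 4}`), and its swap;
* `no_law_cube_13e_of_onto_z5z5`, `no_law_cube_1d3_of_onto_z5z5`, `no_law_cube_14e_of_onto_z5z5`,
  `no_law_cube_1d4_of_onto_z5z5` — the TPP statements: no triple with coset parts `(1,1 | 3,3 | e,e)` / `(1,1 | d,d | 3,3)` /
  `(1,1 | 4,4 | e,e)` / `(1,1 | d,d | 4,4)` attains `3|S||T||U| + 8 = 8|A|` in any dihedral-like group over `A ↠ ℤ₅²`.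
-/

namespace Summit.MatrixMultiplication.OmegaCensus

open Finset Z5Z5Domino

/-! (The fibre-count bridges `sum_card_fibre_shift` / `sum_filter_card_fibre_shift` are the landed ones of
`DominoZpZpGL2.lean`, namespace `ZpZpDomino`.) -/

section Z5

/-- Applying `lineMap`. [folklore] -/
@[simp] theorem Z5Z5Domino.lineMap_apply {q : ℕ} (a b : ZMod q) (u : ZMod q × ZMod q) :
    lineMap a b u = a * u.1 + b * u.2 := rfl

/-- The six line maps are onto. [folklore] -/
theorem Z5Z5Domino.lineMapDir_surjective (j : ℕ) : Function.Surjective (lineMapDir j) := by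
  intro t
  by_cases hj : j = 1
  · exact ⟨(0, t), by simp [lineMapDir, dirSnd, hj]⟩
  · exact ⟨(t, 0), by simp [lineMapDir, dirFst, hj]⟩

/-- The line map of a point has value `pv`. [folklore] -/
theorem Z5Z5Domino.lineMapDir_pt_eq_iff {j : ℕ} (hj : j < 6) (i : Fin 25) {v : ℕ} (hv : v < 5) :
    lineMapDir j (pt i.val) = ((v : ℕ) : ZMod 5) ↔ pv j i.val = v := by
  have h := pv_spec j hj i.val i.isLt
  constructor
  · intro e
    rw [e, ZMod.val_natCast, Nat.mod_eq_of_lt hv] at h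
    exact h.symm
  · intro e
    apply ZMod.val_injective 5
    rw [h, e, ZMod.val_natCast, Nat.mod_eq_of_lt hv]

/-- A sum over `ZMod 5 × ZMod 5` as a sum over the `25` numbered points. [folklore] -/
theorem Z5Z5Domino.sum_eq_sum_pt (H : ZMod 5 × ZMod 5 → ℕ) : ∑ u, H u = ∑ i : Fin 25, H (pt i.val) :=
  (Fintype.sum_equiv ptEquiv (fun i => H (pt i.val)) H fun _ => rfl).symm

/-- The filtered sum along direction `j` as the kit's `pick`-sum. [folklore] -/
theorem Z5Z5Domino.sum_filter_eq_sum_pick {j : ℕ} (hj : j < 6) (H : ZMod 5 × ZMod 5 → ℕ) {v : ℕ} (hv : v < 5) :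
    ∑ u ∈ univ.filter (fun u => lineMapDir j u = ((v : ℕ) : ZMod 5)), H u =
      ∑ i : Fin 25, pick v (pv j i.val) (H (pt i.val)) := by
  rw [sum_filter, Z5Z5Domino.sum_eq_sum_pt]
  refine Fintype.sum_congr _ _ fun i => ?_
  unfold pick
  by_cases hc : pv j i.val = v
  · rw [if_pos ((Z5Z5Domino.lineMapDir_pt_eq_iff hj i hv).2 hc), if_pos hc]
  · rw [if_neg (fun e => hc ((Z5Z5Domino.lineMapDir_pt_eq_iff hj i hv).1 e)), if_neg hc]

variable {A : Type*} [AddCommGroup A] [DecidableEq A] [Fintype A]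

/-- **Core theorem.**  For a surjection `Φ : A →+ ZMod 5 × ZMod 5` there is no domino shifted form with `|X| ∈ {3, 4}`:
`X + Y` direct and `(X+Y) ⊔ (β + (Y−X)) ⊔ (γ + (X−Y)) = A ∖ {x₀}`. [folklore] -/
theorem no_shifted_form_of_onto_z5z5 (Φ : A →+ ZMod 5 × ZMod 5) (hΦ : Function.Surjective Φ)
    {X Y : Finset A} {β γ x₀ : A} (hX : X.card = 3 ∨ X.card = 4)
    (hinj : Set.InjOn (fun p : A × A => p.1 + p.2) ↑(X ×ˢ Y))
    (hPQ : Disjoint ((X ×ˢ Y).image fun p : A × A => p.1 + p.2)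
      (((Y ×ˢ X).image fun p : A × A => p.1 - p.2).image fun z => z + β))
    (hPR : Disjoint ((X ×ˢ Y).image fun p : A × A => p.1 + p.2)
      (((X ×ˢ Y).image fun p : A × A => p.1 - p.2).image fun z => z + γ))
    (hQR : Disjoint (((Y ×ˢ X).image fun p : A × A => p.1 - p.2).image fun z => z + β)
      (((X ×ˢ Y).image fun p : A × A => p.1 - p.2).image fun z => z + γ))
    (hcover : ((X ×ˢ Y).image fun p : A × A => p.1 + p.2) ∪
      (((Y ×ˢ X).image fun p : A × A => p.1 - p.2).image fun z => z + β) ∪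
      (((X ×ˢ Y).image fun p : A × A => p.1 - p.2).image fun z => z + γ) = univ.erase x₀) : False := by
  classical
  -- the translated image multiset of `X`: `u ↦ |X ∩ Φ⁻¹(u + Φ(3β))|`, and its `25` values
  set h3 : ZMod 5 × ZMod 5 := Φ (β + β + β) with h3def
  have hsumg : ∑ i : Fin 25, (X.filter fun a => Φ a = pt i.val + h3).card = X.card := by
    have h0 := ZpZpDomino.sum_card_fibre_shift Φ X h3
    rw [Z5Z5Domino.sum_eq_sum_pt] at h0
    exact h0
  -- a certified table entry for some line projection
  have main : ∃ j < 6, ∃ cnt : List ℕ, ∃ certs : List (ℕ × List ℕ), lineCert 5 (vecFn cnt) certs = true ∧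
      ∀ v < 5, cnt.getD v 0 = ∑ i : Fin 25, pick v (pv j i.val) ((X.filter fun a => Φ a = pt i.val + h3).card) := by
    rcases hX with hX3 | hX4
    · obtain ⟨j, hj, e, he, hev⟩ :=
        exists_table_entry_three (fun i => (X.filter fun a => Φ a = pt i.val + h3).card) (by rw [hsumg, hX3])
      exact ⟨j, hj, e.1, e.2, table3_cert e he, hev⟩
    · obtain ⟨j, hj, e, he, hev⟩ :=
        exists_table_entry_four (fun i => (X.filter fun a => Φ a = pt i.val + h3).card) (by rw [hsumg, hX4])
      exact ⟨j, hj, e.1, e.2, table4_cert e he, hev⟩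
  obtain ⟨j, hj, cnt, certs, hcert, hev⟩ := main
  -- the line identity in direction `j`
  set π : ZMod 5 × ZMod 5 →+ ZMod 5 := lineMapDir j with hπ
  set φ : A →+ ZMod 5 := π.comp Φ with hφ
  have hφsurj : Function.Surjective φ := (Z5Z5Domino.lineMapDir_surjective j).comp hΦ
  have hη : (3 : ZMod 5) + 3 = 1 := by decide
  -- the projected counts are the table's count vector
  have hFw : ∀ w : ZMod 5, (X.filter fun a => φ a = w + 3 * φ β).card = vecFn cnt w := by
    intro w
    have e1 := hev w.val (ZMod.val_lt w)
    have e2 := Z5Z5Domino.sum_filter_eq_sum_pick hj (fun u => (X.filter fun a => Φ a = u + h3).card) (ZMod.val_lt w)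
    beta_reduce at e2
    rw [← e2, ZMod.natCast_zmod_val, ZpZpDomino.sum_filter_card_fibre_shift Φ π X h3 w] at e1
    show _ = cnt.getD w.val 0
    rw [e1]
    refine congrArg Finset.card (Finset.filter_congr fun a _ => ?_)
    have eφ : ∀ x, φ x = π (Φ x) := fun x => rfl
    have eh : π h3 = π (Φ β) + π (Φ β) + π (Φ β) := by rw [h3def, map_add, map_add, map_add, map_add]
    rw [eφ, eφ, eh]
    constructor
    · intro e; rw [e]; ring
    · intro e; rw [e]; ring
  have hid : ∀ τ : ZMod 5, (∑ v : ZMod 5, (vecFn cnt (τ - v) + vecFn cnt (v - τ) + vecFn cnt (τ + v)) *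
        (Y.filter fun a => φ a = v + 3 * φ γ).card) + (if φ x₀ - 3 * φ β - 3 * φ γ = τ then 1 else 0) =
        (univ.filter fun a : A => φ a = 0).card := fun τ => by
    have h0 := line_identity_of_shifted_form φ 3 hη hinj hPQ hPR hQR hcover τ
    rw [card_fibre_eq_of_surjective φ hφsurj (τ + 3 * φ β + 3 * φ γ) 0] at h0
    simp only [hFw] at h0
    exact h0
  exact lineCert_sound hcert _ _ _ hid

/-- **Core theorem, parts swapped** (`|Y| ∈ {3, 4}`): the form is symmetric under `(X, β) ↔ (Y, γ)`. [folklore] -/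
theorem no_shifted_form_of_onto_z5z5' (Φ : A →+ ZMod 5 × ZMod 5) (hΦ : Function.Surjective Φ)
    {X Y : Finset A} {β γ x₀ : A} (hY : Y.card = 3 ∨ Y.card = 4)
    (hinj : Set.InjOn (fun p : A × A => p.1 + p.2) ↑(X ×ˢ Y))
    (hPQ : Disjoint ((X ×ˢ Y).image fun p : A × A => p.1 + p.2)
      (((Y ×ˢ X).image fun p : A × A => p.1 - p.2).image fun z => z + β))
    (hPR : Disjoint ((X ×ˢ Y).image fun p : A × A => p.1 + p.2)
      (((X ×ˢ Y).image fun p : A × A => p.1 - p.2).image fun z => z + γ))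
    (hQR : Disjoint (((Y ×ˢ X).image fun p : A × A => p.1 - p.2).image fun z => z + β)
      (((X ×ˢ Y).image fun p : A × A => p.1 - p.2).image fun z => z + γ))
    (hcover : ((X ×ˢ Y).image fun p : A × A => p.1 + p.2) ∪
      (((Y ×ˢ X).image fun p : A × A => p.1 - p.2).image fun z => z + β) ∪
      (((X ×ˢ Y).image fun p : A × A => p.1 - p.2).image fun z => z + γ) = univ.erase x₀) : False := by
  have himg := image_add_swap X Y
  refine no_shifted_form_of_onto_z5z5 Φ hΦ (X := Y) (Y := X) (β := γ) (γ := β) (x₀ := x₀) hY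
    (injOn_add_swap hinj) ?_ ?_ hQR.symm ?_
  · rw [himg]; exact hPR
  · rw [himg]; exact hPQ
  · rw [himg, union_right_comm]; exact hcover

end Z5

/-! ## The TPP statements -/

section DihedralLike

variable {A : Type} [AddCommGroup A] [DecidableEq A] [Fintype A] {G : Type} [Group G] [DecidableEq G]
  {ρ τ : A → G} {c₀ : A} {S T U : Finset G}

open Literature.Combinatorics.Additive

/-- **No `(1,1 | 3,3 | e,e)` or `(1,1 | 4,4 | e,e)` law triple over `A ↠ ℤ₅ × ℤ₅`.**  Dihedral-like `G` over `A` (any `c₀`),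
`φ : A →+ ZMod 5 × ZMod 5` onto; a TPP triple with coset parts `|S₀| = |S₁| = 1`, `|T₀| = |T₁| ∈ {3, 4}`, `|U₀| = |U₁|`.
Then `3|S||T||U| + 8 ≠ 8|A|`. [folklore] -/
theorem no_law_cube_1de_of_onto_z5z5 {d : ℕ} (hd : d = 3 ∨ d = 4)
    (hρρ : ∀ a b, ρ a * ρ b = ρ (a + b)) (hρτ : ∀ a b, ρ a * τ b = τ (b - a))
    (hτρ : ∀ a b, τ a * ρ b = τ (a + b)) (hττ : ∀ a b, τ a * τ b = ρ (c₀ + b - a))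
    (hρ : Function.Injective ρ) (hτ : Function.Injective τ) (hne : ∀ a b, ρ a ≠ τ b)
    (hsurj : ∀ g, (∃ a, ρ a = g) ∨ (∃ a, τ a = g))
    (φ : A →+ ZMod 5 × ZMod 5) (hφ : Function.Surjective φ)
    (h : TripleProductProperty S T U)
    (hS₀ : (univ.filter fun a : A => ρ a ∈ S).card = 1) (hS₁ : (univ.filter fun a : A => τ a ∈ S).card = 1)
    (hT₀ : (univ.filter fun a : A => ρ a ∈ T).card = d) (hT₁ : (univ.filter fun a : A => τ a ∈ T).card = d)
    (hU : (univ.filter fun a : A => ρ a ∈ U).card = (univ.filter fun a : A => τ a ∈ U).card)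
    (hV : 3 * (S.card * T.card * U.card) + 8 = 8 * Fintype.card A) : False := by
  classical
  obtain ⟨X, Y, β, γ, x₀, hXc, -, hinj, hPQ, hPR, hQR, hcover⟩ :=
    domino_shifted_form_of_law hρρ hρτ hτρ hττ hρ hτ hne hsurj h hS₀ hS₁ (by rw [hT₀, hT₁]) hU hV
  rw [hT₀] at hXc
  exact no_shifted_form_of_onto_z5z5 φ hφ (by rw [hXc]; exact hd) hinj hPQ hPR hQR hcover

/-- **No `(1,1 | d,d | 3,3)` or `(1,1 | d,d | 4,4)` law triple over `A ↠ ℤ₅ × ℤ₅`** (the small parts in `U`). [folklore] -/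
theorem no_law_cube_1d_e_of_onto_z5z5 {e : ℕ} (he : e = 3 ∨ e = 4)
    (hρρ : ∀ a b, ρ a * ρ b = ρ (a + b)) (hρτ : ∀ a b, ρ a * τ b = τ (b - a))
    (hτρ : ∀ a b, τ a * ρ b = τ (a + b)) (hττ : ∀ a b, τ a * τ b = ρ (c₀ + b - a))
    (hρ : Function.Injective ρ) (hτ : Function.Injective τ) (hne : ∀ a b, ρ a ≠ τ b)
    (hsurj : ∀ g, (∃ a, ρ a = g) ∨ (∃ a, τ a = g))
    (φ : A →+ ZMod 5 × ZMod 5) (hφ : Function.Surjective φ)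
    (h : TripleProductProperty S T U)
    (hS₀ : (univ.filter fun a : A => ρ a ∈ S).card = 1) (hS₁ : (univ.filter fun a : A => τ a ∈ S).card = 1)
    (hT : (univ.filter fun a : A => ρ a ∈ T).card = (univ.filter fun a : A => τ a ∈ T).card)
    (hU₀ : (univ.filter fun a : A => ρ a ∈ U).card = e) (hU₁ : (univ.filter fun a : A => τ a ∈ U).card = e)
    (hV : 3 * (S.card * T.card * U.card) + 8 = 8 * Fintype.card A) : False := by
  classical
  obtain ⟨X, Y, β, γ, x₀, -, hYc, hinj, hPQ, hPR, hQR, hcover⟩ :=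
    domino_shifted_form_of_law hρρ hρτ hτρ hττ hρ hτ hne hsurj h hS₀ hS₁ hT (by rw [hU₀, hU₁]) hV
  rw [hU₀] at hYc
  exact no_shifted_form_of_onto_z5z5' φ hφ (by rw [hYc]; exact he) hinj hPQ hPR hQR hcover

/-- **Cell form `(1, 3, e)`**: no TPP triple with parts `(1,1 | 3,3 | e,e)` attains the mod-one law over `A ↠ ℤ₅²`. [folklore] -/
theorem no_law_cube_13e_of_onto_z5z5
    (hρρ : ∀ a b, ρ a * ρ b = ρ (a + b)) (hρτ : ∀ a b, ρ a * τ b = τ (b - a))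
    (hτρ : ∀ a b, τ a * ρ b = τ (a + b)) (hττ : ∀ a b, τ a * τ b = ρ (c₀ + b - a))
    (hρ : Function.Injective ρ) (hτ : Function.Injective τ) (hne : ∀ a b, ρ a ≠ τ b)
    (hsurj : ∀ g, (∃ a, ρ a = g) ∨ (∃ a, τ a = g))
    (φ : A →+ ZMod 5 × ZMod 5) (hφ : Function.Surjective φ)
    (h : TripleProductProperty S T U)
    (hS₀ : (univ.filter fun a : A => ρ a ∈ S).card = 1) (hS₁ : (univ.filter fun a : A => τ a ∈ S).card = 1)
    (hT₀ : (univ.filter fun a : A => ρ a ∈ T).card = 3) (hT₁ : (univ.filter fun a : A => τ a ∈ T).card = 3)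
    (hU : (univ.filter fun a : A => ρ a ∈ U).card = (univ.filter fun a : A => τ a ∈ U).card)
    (hV : 3 * (S.card * T.card * U.card) + 8 = 8 * Fintype.card A) : False :=
  no_law_cube_1de_of_onto_z5z5 (Or.inl rfl) hρρ hρτ hτρ hττ hρ hτ hne hsurj φ hφ h hS₀ hS₁ hT₀ hT₁ hU hV

/-- **Cell form `(1, 4, e)`**: no TPP triple with parts `(1,1 | 4,4 | e,e)` attains the mod-one law over `A ↠ ℤ₅²`. [folklore] -/
theorem no_law_cube_14e_of_onto_z5z5
    (hρρ : ∀ a b, ρ a * ρ b = ρ (a + b)) (hρτ : ∀ a b, ρ a * τ b = τ (b - a))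
    (hτρ : ∀ a b, τ a * ρ b = τ (a + b)) (hττ : ∀ a b, τ a * τ b = ρ (c₀ + b - a))
    (hρ : Function.Injective ρ) (hτ : Function.Injective τ) (hne : ∀ a b, ρ a ≠ τ b)
    (hsurj : ∀ g, (∃ a, ρ a = g) ∨ (∃ a, τ a = g))
    (φ : A →+ ZMod 5 × ZMod 5) (hφ : Function.Surjective φ)
    (h : TripleProductProperty S T U)
    (hS₀ : (univ.filter fun a : A => ρ a ∈ S).card = 1) (hS₁ : (univ.filter fun a : A => τ a ∈ S).card = 1)
    (hT₀ : (univ.filter fun a : A => ρ a ∈ T).card = 4) (hT₁ : (univ.filter fun a : A => τ a ∈ T).card = 4)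
    (hU : (univ.filter fun a : A => ρ a ∈ U).card = (univ.filter fun a : A => τ a ∈ U).card)
    (hV : 3 * (S.card * T.card * U.card) + 8 = 8 * Fintype.card A) : False :=
  no_law_cube_1de_of_onto_z5z5 (Or.inr rfl) hρρ hρτ hτρ hττ hρ hτ hne hsurj φ hφ h hS₀ hS₁ hT₀ hT₁ hU hV

end DihedralLike

end Summit.MatrixMultiplication.OmegaCensus
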